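import Mathlib

/-!
# Crux `WordLengthQP` (stmt-ValiantsHypothesis-6623), line `Sketch` (eps-order-ladder) —
stub `stub_continuantTop`

Allender–Wang 2016 ("On the power of algebraic branching programs of width two", Computational
Complexity 25), Theorem 18 / Remark 19, in the S-affine width-2 model: a constant combination
`f = c₀ · K(L₁,…,Lₘ) + c₁ · K(L₁,…,L_{m-1})` of the first-row entries (continuants) of a product
`∏ᵢ !![Lᵢ, 1; 1, 0]` of letters with affine `Lᵢ` whose INTERIOR members are non-constant is `0`, or
its top homogeneous part is a non-zero constant times a product of (non-zero) linear forms.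

Proof: write `f` as entry `0` of `!![α,1;1,0] *ᵥ (M(core) *ᵥ (!![β,1;1,0] *ᵥ (C c₀, C c₁)))` and
push the column vector through the letters of the non-constant `core` one at a time, carrying the
invariant "both entries are `0` or have a top part of the required shape, and the second entry is
constant or of smaller degree than the first"; the key algebra is `top (p q) = top p · top q` and
`top (p + q) = top p` for `deg q < deg p`.
-/

-- `Summit.ValiantsHypothesis.ValiantsHypothesis.…` is the tree's mandated single-conjunct layout
-- (Sub = Summit), so the duplicated namespace component is intended.
set_option linter.dupNamespace false

noncomputable section

open MvPolynomial
open scoped Matrix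

namespace Summit.ValiantsHypothesis.ValiantsHypothesis.Cruxes.WordLengthQP.EpsOrderLadder

variable {σ : Type*}

/-! ### Generic facts on top homogeneous parts -/

/-- The homogeneous component of `p * q` in degree `deg p + deg q` is the product of the top
homogeneous components of `p` and `q` (over any commutative semiring). [folklore] -/
theorem continuantTop_homogeneousComponent_mul {R : Type*} [CommSemiring R]
    (p q : MvPolynomial σ R) :
    homogeneousComponent (p.totalDegree + q.totalDegree) (p * q) =
      homogeneousComponent p.totalDegree p * homogeneousComponent q.totalDegree q := by
  classical
  ext d
  rw [coeff_homogeneousComponent, coeff_mul, coeff_mul]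
  split_ifs with hd
  · refine Finset.sum_congr rfl fun x hx => ?_
    rw [coeff_homogeneousComponent, coeff_homogeneousComponent]
    have hx' : x.1 + x.2 = d := Finset.HasAntidiagonal.mem_antidiagonal.1 hx
    by_cases hp : coeff x.1 p = 0
    · simp [hp]
    by_cases hq : coeff x.2 q = 0
    · simp [hq]
    have h1 : x.1.degree ≤ p.totalDegree := le_totalDegree (mem_support_iff.2 hp)
    have h2 : x.2.degree ≤ q.totalDegree := le_totalDegree (mem_support_iff.2 hq)
    have hsum : x.1.degree + x.2.degree = p.totalDegree + q.totalDegree := by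
      rw [← hd, ← hx', map_add]
    rw [if_pos (by omega), if_pos (by omega)]
  · symm
    refine Finset.sum_eq_zero fun x hx => ?_
    rw [coeff_homogeneousComponent, coeff_homogeneousComponent]
    split_ifs with h1 h2
    · exfalso
      apply hd
      rw [← Finset.HasAntidiagonal.mem_antidiagonal.1 hx, map_add, h1, h2]
    all_goals simp

/-- Over `ℂ`, for non-zero `p`, `q`: `deg (p q) = deg p + deg q`, and the top part of `p q` is the
product of the top parts. [folklore] -/
theorem continuantTop_top_mul {p q : MvPolynomial σ ℂ} (hp : p ≠ 0) (hq : q ≠ 0) :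
    (p * q).totalDegree = p.totalDegree + q.totalDegree ∧
      homogeneousComponent (p * q).totalDegree (p * q) =
        homogeneousComponent p.totalDegree p * homogeneousComponent q.totalDegree q := by
  have h := totalDegree_mul_of_isDomain hp hq
  exact ⟨h, by rw [h, continuantTop_homogeneousComponent_mul]⟩

/-- Adding a polynomial of smaller degree changes neither the degree nor the top part.
[folklore] -/
theorem continuantTop_top_add {p q : MvPolynomial σ ℂ}
    (h : q = 0 ∨ q.totalDegree < p.totalDegree) :
    (p + q).totalDegree = p.totalDegree ∧
      homogeneousComponent (p + q).totalDegree (p + q) =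
        homogeneousComponent p.totalDegree p := by
  rcases h with rfl | h
  · simp
  · have h1 := totalDegree_add_eq_left_of_totalDegree_lt h
    refine ⟨h1, ?_⟩
    rw [h1, map_add, homogeneousComponent_eq_zero _ _ h, add_zero]

/-- Multiplying by a non-zero constant changes neither the degree nor (up to that constant) the
top part. [folklore] -/
theorem continuantTop_top_C_mul {p : MvPolynomial σ ℂ} {a : ℂ} (ha : a ≠ 0) :
    (C a * p).totalDegree = p.totalDegree ∧
      homogeneousComponent (C a * p).totalDegree (C a * p) =
        C a * homogeneousComponent p.totalDegree p := by
  have h1 : (C a * p).totalDegree = p.totalDegree := by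
    by_cases hp : p = 0
    · simp [hp]
    · rw [totalDegree_mul_of_isDomain (C_ne_zero.2 ha) hp, totalDegree_C, zero_add]
  exact ⟨h1, by rw [h1, homogeneousComponent_C_mul]⟩

/-- A non-constant affine form has degree `1`, and its top part `homogeneousComponent 1 L` is a
non-zero linear form. [folklore] -/
theorem continuantTop_affine {L : MvPolynomial σ ℂ} (h1 : L.totalDegree ≤ 1)
    (h0 : 0 < L.totalDegree) :
    L.totalDegree = 1 ∧ (homogeneousComponent 1 L).IsHomogeneous 1 ∧
      homogeneousComponent 1 L ≠ 0 := by
  classical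
  have hd : L.totalDegree = 1 := le_antisymm h1 h0
  refine ⟨hd, homogeneousComponent_isHomogeneous 1 L, ?_⟩
  have hL : L ≠ 0 := by
    rintro rfl
    simp at h0
  -- a monomial `e` of degree `deg L = 1` exists, and its coefficient survives in the top part
  obtain ⟨e, he, hedeg⟩ := Finset.exists_mem_eq_sup L.support
    (Finset.nonempty_of_ne_empty (by rwa [Ne, support_eq_empty])) (fun s => s.sum fun _ n => n)
  intro h
  have := congrArg (coeff e) h
  rw [coeff_homogeneousComponent, coeff_zero, if_pos] at this
  · exact (mem_support_iff.1 he) this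
  · rw [← hd, totalDegree, hedeg, Finsupp.degree_apply]
    rfl

/-- A product of non-zero linear forms is homogeneous of degree the number of factors, and is
non-zero. [folklore] -/
theorem continuantTop_prod_lins (ls : List (MvPolynomial σ ℂ))
    (h : ∀ l ∈ ls, l.IsHomogeneous 1 ∧ l ≠ 0) :
    ls.prod.IsHomogeneous ls.length ∧ ls.prod ≠ 0 := by
  induction ls with
  | nil => exact ⟨by simpa using isHomogeneous_one σ ℂ, one_ne_zero⟩
  | cons l ls ih =>
    have hl := h l (by simp)
    have ht := ih (fun l' hl' => h l' (by simp [hl']))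
    refine ⟨?_, ?_⟩
    · simpa [List.prod_cons, List.length_cons, add_comm] using hl.1.mul ht.1
    · simpa [List.prod_cons] using mul_ne_zero hl.2 ht.2

/-- A polynomial whose top part is a non-zero constant times a product of non-zero linear forms
is non-zero. [folklore] -/
theorem continuantTop_ne_zero_of_top {f : MvPolynomial σ ℂ} {κ : ℂ} (hκ : κ ≠ 0)
    {lins : List (MvPolynomial σ ℂ)} (hlins : ∀ l ∈ lins, l.IsHomogeneous 1 ∧ l ≠ 0)
    (htop : homogeneousComponent f.totalDegree f = C κ * lins.prod) : f ≠ 0 := by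
  rintro rfl
  rw [map_zero] at htop
  exact mul_ne_zero (C_ne_zero.2 hκ) (continuantTop_prod_lins lins hlins).2 htop.symm

/-- Multiplying by a non-constant affine form `L`: the degree goes up by one and the top part
acquires the extra linear factor `homogeneousComponent 1 L`. [folklore] -/
theorem continuantTop_top_lin_mul {A L : MvPolynomial σ ℂ} (hA : A ≠ 0)
    (h1 : L.totalDegree ≤ 1) (h0 : 0 < L.totalDegree) {κ : ℂ} {lins : List (MvPolynomial σ ℂ)}
    (htop : homogeneousComponent A.totalDegree A = C κ * lins.prod) :
    (L * A).totalDegree = A.totalDegree + 1 ∧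
      homogeneousComponent (L * A).totalDegree (L * A) =
        C κ * (homogeneousComponent 1 L :: lins).prod := by
  have hL : L ≠ 0 := by
    rintro rfl
    simp at h0
  have hd : L.totalDegree = 1 := le_antisymm h1 h0
  obtain ⟨hdeg, htop'⟩ := continuantTop_top_mul hL hA
  refine ⟨by rw [hdeg, hd, add_comm], ?_⟩
  rw [htop', htop, hd, List.prod_cons]
  ring

/-- An affine combination `L * A + B` of two constants `A`, `B` with an affine `L` has degree
`≤ 1`. [folklore] -/
theorem continuantTop_deg_affine_comb {L A B : MvPolynomial σ ℂ} (hL : L.totalDegree ≤ 1)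
    (hA : A.totalDegree = 0) (hB : B.totalDegree = 0) : (L * A + B).totalDegree ≤ 1 :=
  (totalDegree_add _ _).trans (max_le ((totalDegree_mul _ _).trans (by omega)) (by omega))

/-! ### "Good" polynomials: `0`, or top part = non-zero constant × product of linear forms -/

/-- A polynomial of degree `≤ 1` is `0`, or its top part is a non-zero constant times a product of
(at most one) non-zero linear forms. [folklore] -/
theorem continuantTop_good_of_le_one {f : MvPolynomial σ ℂ} (hf : f.totalDegree ≤ 1) :
    f = 0 ∨ ∃ (κ : ℂ) (lins : List (MvPolynomial σ ℂ)), κ ≠ 0 ∧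
      (∀ l ∈ lins, l.IsHomogeneous 1 ∧ l ≠ 0) ∧
      homogeneousComponent f.totalDegree f = C κ * lins.prod := by
  by_cases hf0 : f = 0
  · exact Or.inl hf0
  right
  rcases Nat.eq_zero_or_pos f.totalDegree with hd | hd
  · refine ⟨coeff 0 f, [], fun h => hf0 ?_, by simp, ?_⟩
    · rw [totalDegree_eq_zero_iff_eq_C.1 hd, h, C_0]
    · rw [hd, homogeneousComponent_zero, List.prod_nil, mul_one]
  · obtain ⟨hd1, hhom, hne⟩ := continuantTop_affine hf hd
    refine ⟨1, [homogeneousComponent 1 f], one_ne_zero, by simpa using And.intro hhom hne, ?_⟩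
    rw [hd1, C_1, one_mul, List.prod_singleton]

/-- The inductive step through a NON-CONSTANT letter `!![L, 1; 1, 0]`: the invariant
"`A` and `B` are good, and `B` is constant or `deg B < deg A`" passes from the column `(A, B)`
to the column `(L A + B, A)`. [folklore] -/
theorem continuantTop_step {A B L : MvPolynomial σ ℂ} (h1 : L.totalDegree ≤ 1)
    (h0 : 0 < L.totalDegree)
    (hA : A = 0 ∨ ∃ (κ : ℂ) (lins : List (MvPolynomial σ ℂ)), κ ≠ 0 ∧
      (∀ l ∈ lins, l.IsHomogeneous 1 ∧ l ≠ 0) ∧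
      homogeneousComponent A.totalDegree A = C κ * lins.prod)
    (hB : B = 0 ∨ ∃ (κ : ℂ) (lins : List (MvPolynomial σ ℂ)), κ ≠ 0 ∧
      (∀ l ∈ lins, l.IsHomogeneous 1 ∧ l ≠ 0) ∧
      homogeneousComponent B.totalDegree B = C κ * lins.prod)
    (hAB : B.totalDegree < A.totalDegree ∨ B.totalDegree = 0) :
    (L * A + B = 0 ∨ ∃ (κ : ℂ) (lins : List (MvPolynomial σ ℂ)), κ ≠ 0 ∧
      (∀ l ∈ lins, l.IsHomogeneous 1 ∧ l ≠ 0) ∧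
      homogeneousComponent (L * A + B).totalDegree (L * A + B) = C κ * lins.prod) ∧
    (A = 0 ∨ ∃ (κ : ℂ) (lins : List (MvPolynomial σ ℂ)), κ ≠ 0 ∧
      (∀ l ∈ lins, l.IsHomogeneous 1 ∧ l ≠ 0) ∧
      homogeneousComponent A.totalDegree A = C κ * lins.prod) ∧
    (A.totalDegree < (L * A + B).totalDegree ∨ A.totalDegree = 0) := by
  rcases hA with rfl | ⟨κ, lins, hκ, hlins, htop⟩
  · exact ⟨by simpa using hB, Or.inl rfl, Or.inr (by simp)⟩
  · have hA0 : A ≠ 0 := continuantTop_ne_zero_of_top hκ hlins htop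
    obtain ⟨hdeg1, htop1⟩ := continuantTop_top_lin_mul hA0 h1 h0 htop
    have hlt : B = 0 ∨ B.totalDegree < (L * A).totalDegree := Or.inr (by omega)
    obtain ⟨hdeg2, htop2⟩ := continuantTop_top_add hlt
    obtain ⟨-, hLh, hLne⟩ := continuantTop_affine h1 h0
    refine ⟨Or.inr ⟨κ, homogeneousComponent 1 L :: lins, hκ, ?_, ?_⟩,
      Or.inr ⟨κ, lins, hκ, hlins, htop⟩, Or.inl (by omega)⟩
    · intro l hl
      rcases List.mem_cons.1 hl with rfl | hl
      · exact ⟨hLh, hLne⟩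
      · exact hlins l hl
    · rw [htop2, htop1]

/-- The first (rightmost) letter `!![L, 1; 1, 0]`, `L` an ARBITRARY affine form, applied to a
constant column `(A, B)` yields a column satisfying the invariant of `continuantTop_step`.
[folklore] -/
theorem continuantTop_step₀ {A B L : MvPolynomial σ ℂ} (h1 : L.totalDegree ≤ 1)
    (hA : A.totalDegree = 0) (hB : B.totalDegree = 0) :
    (L * A + B = 0 ∨ ∃ (κ : ℂ) (lins : List (MvPolynomial σ ℂ)), κ ≠ 0 ∧
      (∀ l ∈ lins, l.IsHomogeneous 1 ∧ l ≠ 0) ∧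
      homogeneousComponent (L * A + B).totalDegree (L * A + B) = C κ * lins.prod) ∧
    (A = 0 ∨ ∃ (κ : ℂ) (lins : List (MvPolynomial σ ℂ)), κ ≠ 0 ∧
      (∀ l ∈ lins, l.IsHomogeneous 1 ∧ l ≠ 0) ∧
      homogeneousComponent A.totalDegree A = C κ * lins.prod) ∧
    (A.totalDegree < (L * A + B).totalDegree ∨ A.totalDegree = 0) :=
  ⟨continuantTop_good_of_le_one (continuantTop_deg_affine_comb h1 hA hB),
    continuantTop_good_of_le_one (by omega), Or.inr hA⟩

/-- The last (leftmost) letter `!![L, 1; 1, 0]`, `L` an ARBITRARY affine form: from a column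
`(A, B)` satisfying the invariant, `L A + B` is good. [folklore] -/
theorem continuantTop_final {A B L : MvPolynomial σ ℂ} (h1 : L.totalDegree ≤ 1)
    (hA : A = 0 ∨ ∃ (κ : ℂ) (lins : List (MvPolynomial σ ℂ)), κ ≠ 0 ∧
      (∀ l ∈ lins, l.IsHomogeneous 1 ∧ l ≠ 0) ∧
      homogeneousComponent A.totalDegree A = C κ * lins.prod)
    (hB : B = 0 ∨ ∃ (κ : ℂ) (lins : List (MvPolynomial σ ℂ)), κ ≠ 0 ∧
      (∀ l ∈ lins, l.IsHomogeneous 1 ∧ l ≠ 0) ∧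
      homogeneousComponent B.totalDegree B = C κ * lins.prod)
    (hAB : B.totalDegree < A.totalDegree ∨ B.totalDegree = 0) :
    L * A + B = 0 ∨ ∃ (κ : ℂ) (lins : List (MvPolynomial σ ℂ)), κ ≠ 0 ∧
      (∀ l ∈ lins, l.IsHomogeneous 1 ∧ l ≠ 0) ∧
      homogeneousComponent (L * A + B).totalDegree (L * A + B) = C κ * lins.prod := by
  rcases Nat.eq_zero_or_pos L.totalDegree with hL | hL
  · by_cases hA0 : A.totalDegree = 0
    · rcases hAB with h | hB0
      · omega
      · exact continuantTop_good_of_le_one (continuantTop_deg_affine_comb h1 hA0 hB0)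
    · have hlt : B.totalDegree < A.totalDegree := by omega
      have hAne : A ≠ 0 := by
        rintro rfl
        simp at hA0
      rcases hA with h | ⟨κ, lins, hκ, hlins, htop⟩
      · exact absurd h hAne
      obtain ⟨a, rfl⟩ : ∃ a : ℂ, L = C a := ⟨_, totalDegree_eq_zero_iff_eq_C.1 hL⟩
      by_cases ha : a = 0
      · rw [ha, C_0, zero_mul, zero_add]
        exact hB
      · right
        obtain ⟨hdeg1, htop1⟩ := continuantTop_top_C_mul (p := A) ha
        obtain ⟨-, htop2⟩ := continuantTop_top_add (p := C a * A) (q := B) (Or.inr (by omega))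
        refine ⟨a * κ, lins, mul_ne_zero ha hκ, hlins, ?_⟩
        rw [htop2, htop1, htop, map_mul, mul_assoc]
  · exact (continuantTop_step h1 hL hA hB hAB).1

/-! ### The letters `!![L, 1; 1, 0]` acting on columns -/

/-- Row bookkeeping for the letter `!![L, 1; 1, 0]` acting on a column vector. [folklore] -/
theorem continuantTop_Q_mulVec (L : MvPolynomial σ ℂ) (w : Fin 2 → MvPolynomial σ ℂ) :
    ((!![L, 1; 1, 0] : Matrix (Fin 2) (Fin 2) (MvPolynomial σ ℂ)) *ᵥ w) 0 = L * w 0 + w 1 ∧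
      ((!![L, 1; 1, 0] : Matrix (Fin 2) (Fin 2) (MvPolynomial σ ℂ)) *ᵥ w) 1 = w 0 := by
  simp [Matrix.mulVec, dotProduct, Fin.sum_univ_two]

/-- Pushing a column vector satisfying the invariant through a product of letters
`!![L, 1; 1, 0]` with NON-CONSTANT affine `L` preserves the invariant. [folklore] -/
theorem continuantTop_iterate (core : List (MvPolynomial σ ℂ))
    (hcore : ∀ L ∈ core, L.totalDegree ≤ 1 ∧ 0 < L.totalDegree)
    (v : Fin 2 → MvPolynomial σ ℂ)
    (hv : (v 0 = 0 ∨ ∃ (κ : ℂ) (lins : List (MvPolynomial σ ℂ)), κ ≠ 0 ∧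
        (∀ l ∈ lins, l.IsHomogeneous 1 ∧ l ≠ 0) ∧
        homogeneousComponent (v 0).totalDegree (v 0) = C κ * lins.prod) ∧
      (v 1 = 0 ∨ ∃ (κ : ℂ) (lins : List (MvPolynomial σ ℂ)), κ ≠ 0 ∧
        (∀ l ∈ lins, l.IsHomogeneous 1 ∧ l ≠ 0) ∧
        homogeneousComponent (v 1).totalDegree (v 1) = C κ * lins.prod) ∧
      ((v 1).totalDegree < (v 0).totalDegree ∨ (v 1).totalDegree = 0)) :
    (((core.map fun L => (!![L, 1; 1, 0] : Matrix (Fin 2) (Fin 2) (MvPolynomial σ ℂ))).prod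
          *ᵥ v) 0 = 0 ∨
        ∃ (κ : ℂ) (lins : List (MvPolynomial σ ℂ)), κ ≠ 0 ∧
          (∀ l ∈ lins, l.IsHomogeneous 1 ∧ l ≠ 0) ∧
          homogeneousComponent
              (((core.map fun L =>
                (!![L, 1; 1, 0] : Matrix (Fin 2) (Fin 2) (MvPolynomial σ ℂ))).prod *ᵥ v)
                  0).totalDegree
              (((core.map fun L =>
                (!![L, 1; 1, 0] : Matrix (Fin 2) (Fin 2) (MvPolynomial σ ℂ))).prod *ᵥ v) 0) =
            C κ * lins.prod) ∧
      (((core.map fun L => (!![L, 1; 1, 0] : Matrix (Fin 2) (Fin 2) (MvPolynomial σ ℂ))).prod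
          *ᵥ v) 1 = 0 ∨
        ∃ (κ : ℂ) (lins : List (MvPolynomial σ ℂ)), κ ≠ 0 ∧
          (∀ l ∈ lins, l.IsHomogeneous 1 ∧ l ≠ 0) ∧
          homogeneousComponent
              (((core.map fun L =>
                (!![L, 1; 1, 0] : Matrix (Fin 2) (Fin 2) (MvPolynomial σ ℂ))).prod *ᵥ v)
                  1).totalDegree
              (((core.map fun L =>
                (!![L, 1; 1, 0] : Matrix (Fin 2) (Fin 2) (MvPolynomial σ ℂ))).prod *ᵥ v) 1) =
            C κ * lins.prod) ∧
      ((((core.map fun L => (!![L, 1; 1, 0] : Matrix (Fin 2) (Fin 2) (MvPolynomial σ ℂ))).prod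
          *ᵥ v) 1).totalDegree <
          (((core.map fun L => (!![L, 1; 1, 0] : Matrix (Fin 2) (Fin 2) (MvPolynomial σ ℂ))).prod
            *ᵥ v) 0).totalDegree ∨
        (((core.map fun L => (!![L, 1; 1, 0] : Matrix (Fin 2) (Fin 2) (MvPolynomial σ ℂ))).prod
          *ᵥ v) 1).totalDegree = 0) := by
  induction core with
  | nil => simpa using hv
  | cons L rest ih =>
    have hrest := ih (fun L' hL' => hcore L' (by simp [hL']))
    have hL := hcore L (by simp)
    rw [List.map_cons, List.prod_cons, ← Matrix.mulVec_mulVec]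
    obtain ⟨h0, h1⟩ := continuantTop_Q_mulVec L
      ((rest.map fun L => (!![L, 1; 1, 0] : Matrix (Fin 2) (Fin 2) (MvPolynomial σ ℂ))).prod *ᵥ v)
    rw [h0, h1]
    exact continuantTop_step hL.1 hL.2 hrest.1 hrest.2.1 hrest.2.2

/-! ### The stub -/

/-- **stub_continuantTop** (Allender–Wang 2016, Thm 18 / Remark 19, S-model): a constant
combination of the first-row entries of a continuant product `∏ᵢ !![Lᵢ, 1; 1, 0]` with affine `Lᵢ`
whose interior members are non-constant is `0`, or its top homogeneous part is a non-zero constant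
times a product of non-zero linear forms. -/
theorem stub_continuantTop {σ : Type} [Fintype σ] [DecidableEq σ]
    (ls : List (MvPolynomial σ ℂ)) (hdeg : ∀ L ∈ ls, L.totalDegree ≤ 1)
    (hint : ∀ (pre suf : List (MvPolynomial σ ℂ)) (L : MvPolynomial σ ℂ),
      ls = pre ++ L :: suf → pre ≠ [] → suf ≠ [] → 0 < L.totalDegree)
    (c : Fin 2 → ℂ) (f : MvPolynomial σ ℂ)
    (hf : f = ∑ j : Fin 2,
      (ls.map (fun L => (!![L, 1; 1, 0] : Matrix (Fin 2) (Fin 2) (MvPolynomial σ ℂ)))).prod 0 j *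
        MvPolynomial.C (c j)) :
    f = 0 ∨ ∃ (κ : ℂ) (lins : List (MvPolynomial σ ℂ)), κ ≠ 0 ∧
      (∀ l ∈ lins, l.IsHomogeneous 1 ∧ l ≠ 0) ∧
      MvPolynomial.homogeneousComponent f.totalDegree f = MvPolynomial.C κ * lins.prod := by
  -- `f` is entry `0` of the product applied to the constant column `(C c₀, C c₁)`
  have hf' : f = ((ls.map (fun L =>
      (!![L, 1; 1, 0] : Matrix (Fin 2) (Fin 2) (MvPolynomial σ ℂ)))).prod *ᵥ
        fun j => C (c j)) 0 := by
    rw [hf]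
    rfl
  clear hf
  subst hf'
  rcases ls with _ | ⟨α, rest⟩
  · -- empty word: `f = C c₀`
    apply continuantTop_good_of_le_one
    simp
  · have hα : α.totalDegree ≤ 1 := hdeg α (by simp)
    rcases rest.eq_nil_or_concat' with rfl | ⟨core, β, rfl⟩
    · -- one letter: `f = α C c₀ + C c₁` is affine
      apply continuantTop_good_of_le_one
      rw [List.map_cons, List.map_nil, List.prod_cons, List.prod_nil, mul_one,
        (continuantTop_Q_mulVec α _).1]
      exact continuantTop_deg_affine_comb hα (totalDegree_C _) (totalDegree_C _)
    · -- `ls = α :: core ++ [β]` with non-constant `core`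
      have hβ : β.totalDegree ≤ 1 := hdeg β (by simp)
      have hcore : ∀ L ∈ core, L.totalDegree ≤ 1 ∧ 0 < L.totalDegree := by
        intro L hL
        obtain ⟨s, t, rfl⟩ := List.append_of_mem hL
        exact ⟨hdeg L (by simp), hint (α :: s) (t ++ [β]) L (by simp) (by simp) (by simp)⟩
      rw [List.map_cons, List.prod_cons, List.map_append, List.prod_append, List.map_cons,
        List.map_nil, List.prod_cons, List.prod_nil, mul_one, ← Matrix.mulVec_mulVec,
        ← Matrix.mulVec_mulVec]
      obtain ⟨hb0, hb1⟩ := continuantTop_Q_mulVec β (fun j => C (c j))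
      have hJ := continuantTop_iterate core hcore
        ((!![β, 1; 1, 0] : Matrix (Fin 2) (Fin 2) (MvPolynomial σ ℂ)) *ᵥ fun j => C (c j)) (by
          rw [hb0, hb1]
          exact continuantTop_step₀ hβ (totalDegree_C _) (totalDegree_C _))
      rw [(continuantTop_Q_mulVec α _).1]
      exact continuantTop_final hα hJ.1 hJ.2.1 hJ.2.2

end Summit.ValiantsHypothesis.ValiantsHypothesis.Cruxes.WordLengthQP.EpsOrderLadder
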